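import Summits.QuantumFields.YangMills.Theorems.ColdStartUniversalityLatticeLangevinDossSussmannFlow
import HarnessLib

/-!
# Route `ColdStartUniversality` (fixed-cut-off SZZ dynamics; LIEB–ROBINSON / LOCALITY package, file 1):
# the Doss–Sussmann field is LINK-LOCALLY Lipschitz — explicit, volume-independent constants

Helper file (seat `ym-line-csu-p1`, g30; `--supports stmt-QuantumFields-24809`).  The Doss–Sussmann random ODE behind the
tree's smoothing programme (g23/g24: `dossSussmann_isPathDrivenSolution`) has the field
`F(p, M)_e = (p_e)ᴴ · D_β(e' ↦ p_{e'} M_{e'})_e · p_e M_e`, `D_β = driftLie β` the Lie drift of Shen–Zhu–Zhu.  The tree knows a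
GLOBAL Lipschitz bound for it with an existential constant (`dossSussmannField_lipschitz_hsForm`, compactness).  Here the bound
is made LOCAL and EXPLICIT, in the Frobenius distance of the tree's Dobrushin files (`frobNorm`):
* §1 Frobenius tools: products of unitaries, the four-factor telescoping estimate, `‖𝐩 X‖_F ≤ ‖X‖_F`;
* §2 ★ `frobNorm_driftLie_sub_le` — for unitary-valued `Q, Q'` (any lattice representation datum `r`, any dimension `d`):
  `‖D_β(Q)_e − D_β(Q')_e‖_F ≤ |β| Σ_{j ≠ e.2} [2‖Q_e − Q'_e‖_F + Σ_{f ∈ the six other links of the two plaquettes through e in the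
  plane {e.2, j}} ‖Q_f − Q'_f‖_F]` — the drift of a link only feels the links of the `2(d−1)` plaquettes through it;
  `frobNorm_driftLie_le` — `‖D_β(Q)_e‖_F ≤ |β|·2(d−1)·√N`;
* §3 ★ `frobNorm_dossSussmannField_sub_le_local` — the same locality for `F(p, ·)` with a unitary frame `p`;
(The `(ℤ/L)³` neighbour count and the weighted `ℓ¹` form used by the Grönwall argument are in the sequel `…LiebRobinsonFieldWeighted`.)
THEOREMS ONLY, no definition, no sorry; all [folklore] (Shen–Zhu–Zhu arXiv:2204.12737 §3 Lemma 3.1 for the form of the drift; the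
locality count is lattice bookkeeping).  HONEST FRAMING: fixed-cut-off algebra at ANY coupling; the constants grow like `|β|`, so
nothing here is uniform along the route's scaling `β'_K → ∞`; no crux, rung or summit statement is proved; the Yang–Mills mass gap is
NOT proved.
-/

set_option autoImplicit false

noncomputable section

namespace Summit.QuantumFields.YangMills.Theorems.ColdStartUniversality.LiebRobinson

open Matrix Finset
open scoped BigOperators Matrix ComplexConjugate
open Literature.MathematicalPhysics.QuantumFieldTheory
open Literature.MathematicalPhysics.QuantumLattice (fundamentalLatticeRep)

/-! ## §1 Frobenius tools -/

section Frob

variable {n : Type*} [Fintype n] [DecidableEq n]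

omit [DecidableEq n] in
/-- A unitary `n × n` matrix has Frobenius norm `√|n|`. [folklore] -/
theorem frobNorm_of_mem_unitaryGroup [DecidableEq n] {U : Matrix n n ℂ} (hU : U ∈ Matrix.unitaryGroup n ℂ) :
    frobNorm U = Real.sqrt (Fintype.card n) := by
  rw [← frobNorm_sq_of_mem_unitaryGroup hU, Real.sqrt_sq (frobNorm_nonneg _)]

/-- The conjugate transpose of a unitary is unitary. [folklore] -/
theorem conjTranspose_mem_unitaryGroup {U : Matrix n n ℂ} (hU : U ∈ Matrix.unitaryGroup n ℂ) :
    Uᴴ ∈ Matrix.unitaryGroup n ℂ := by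
  rw [← Matrix.star_eq_conjTranspose]; exact Unitary.star_mem hU

/-- **Four-factor telescoping**: `‖A₁A₂A₃A₄ − B₁B₂B₃B₄‖_F ≤ Σ_k ‖A_k − B_k‖_F` for unitary factors. [folklore] -/
theorem frobNorm_four_sub_le (A₁ A₂ A₃ A₄ B₁ B₂ B₃ B₄ : Matrix n n ℂ)
    (hA₂ : A₂ ∈ Matrix.unitaryGroup n ℂ) (hA₃ : A₃ ∈ Matrix.unitaryGroup n ℂ) (hA₄ : A₄ ∈ Matrix.unitaryGroup n ℂ)
    (hB₁ : B₁ ∈ Matrix.unitaryGroup n ℂ) (hB₂ : B₂ ∈ Matrix.unitaryGroup n ℂ) (hB₃ : B₃ ∈ Matrix.unitaryGroup n ℂ) :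
    frobNorm (A₁ * A₂ * A₃ * A₄ - B₁ * B₂ * B₃ * B₄) ≤
      frobNorm (A₁ - B₁) + frobNorm (A₂ - B₂) + frobNorm (A₃ - B₃) + frobNorm (A₄ - B₄) := by
  have hsplit : A₁ * A₂ * A₃ * A₄ - B₁ * B₂ * B₃ * B₄ =
      (A₁ - B₁) * A₂ * A₃ * A₄ + B₁ * (A₂ - B₂) * A₃ * A₄ + B₁ * B₂ * (A₃ - B₃) * A₄ + B₁ * B₂ * B₃ * (A₄ - B₄) := by
    simp only [sub_mul, mul_sub]; abel
  rw [hsplit]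
  have h1 : frobNorm ((A₁ - B₁) * A₂ * A₃ * A₄) = frobNorm (A₁ - B₁) := by
    rw [frobNorm_mul_unitary _ hA₄, frobNorm_mul_unitary _ hA₃, frobNorm_mul_unitary _ hA₂]
  have h2 : frobNorm (B₁ * (A₂ - B₂) * A₃ * A₄) = frobNorm (A₂ - B₂) := by
    rw [frobNorm_mul_unitary _ hA₄, frobNorm_mul_unitary _ hA₃, frobNorm_unitary_mul hB₁]
  have h3 : frobNorm (B₁ * B₂ * (A₃ - B₃) * A₄) = frobNorm (A₃ - B₃) := by
    rw [frobNorm_mul_unitary _ hA₄, frobNorm_unitary_mul (Submonoid.mul_mem _ hB₁ hB₂)]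
  have h4 : frobNorm (B₁ * B₂ * B₃ * (A₄ - B₄)) = frobNorm (A₄ - B₄) := by
    rw [frobNorm_unitary_mul (Submonoid.mul_mem _ (Submonoid.mul_mem _ hB₁ hB₂) hB₃)]
  have t1 := frobNorm_add_le ((A₁ - B₁) * A₂ * A₃ * A₄ + B₁ * (A₂ - B₂) * A₃ * A₄ + B₁ * B₂ * (A₃ - B₃) * A₄)
    (B₁ * B₂ * B₃ * (A₄ - B₄))
  have t2 := frobNorm_add_le ((A₁ - B₁) * A₂ * A₃ * A₄ + B₁ * (A₂ - B₂) * A₃ * A₄) (B₁ * B₂ * (A₃ - B₃) * A₄)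
  have t3 := frobNorm_add_le ((A₁ - B₁) * A₂ * A₃ * A₄) (B₁ * (A₂ - B₂) * A₃ * A₄)
  rw [h1] at t3; rw [h2] at t3; rw [h3] at t2; rw [h4] at t1
  linarith

/-- A product of four unitaries is unitary. [folklore] -/
theorem mul_four_mem_unitaryGroup {A₁ A₂ A₃ A₄ : Matrix n n ℂ}
    (h₁ : A₁ ∈ Matrix.unitaryGroup n ℂ) (h₂ : A₂ ∈ Matrix.unitaryGroup n ℂ) (h₃ : A₃ ∈ Matrix.unitaryGroup n ℂ)
    (h₄ : A₄ ∈ Matrix.unitaryGroup n ℂ) : A₁ * A₂ * A₃ * A₄ ∈ Matrix.unitaryGroup n ℂ :=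
  Submonoid.mul_mem _ (Submonoid.mul_mem _ (Submonoid.mul_mem _ h₁ h₂) h₃) h₄

end Frob

/-! ## §1b. The Lie projection does not increase the Frobenius norm -/

section Proj

variable {G : Type*} [Group G] [TopologicalSpace G] (r : LatticeRep G)

/-- `Re tr(X Xᴴ) = ‖X‖_F²`. [folklore] -/
theorem hsForm_self_eq_frobNorm_sq {N : ℕ} (X : Matrix (Fin N) (Fin N) ℂ) : hsForm N X X = frobNorm X ^ 2 := by
  rw [hsForm_self, frobNorm_sq]

/-- **`‖𝐩 X‖_F ≤ ‖X‖_F`**: the Hilbert–Schmidt orthogonal projection onto `𝔤` is a contraction. [folklore] -/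
theorem frobNorm_lieProj_le (X : Matrix (Fin r.N) (Fin r.N) ℂ) : frobNorm (r.lieProj X) ≤ frobNorm X := by
  have h0 : hsForm r.N (r.lieProj X) (X - r.lieProj X) = 0 := r.hsForm_sub_lieProj (r.lieProj_mem X)
  have hdecomp : hsForm r.N X X =
      hsForm r.N (r.lieProj X) (r.lieProj X) + hsForm r.N (X - r.lieProj X) (X - r.lieProj X) := by
    have h0' : hsForm r.N (X - r.lieProj X) (r.lieProj X) = 0 := by rw [hsForm_comm]; exact h0
    have hx : hsForm r.N X X = hsForm r.N (r.lieProj X + (X - r.lieProj X)) (r.lieProj X + (X - r.lieProj X)) := by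
      rw [add_sub_cancel]
    rw [hx]
    simp only [map_add, LinearMap.add_apply, h0, h0']
    ring
  have hle : frobNorm (r.lieProj X) ^ 2 ≤ frobNorm X ^ 2 := by
    rw [← hsForm_self_eq_frobNorm_sq, ← hsForm_self_eq_frobNorm_sq, hdecomp]
    exact le_add_of_nonneg_right (hsForm_self_nonneg _)
  exact (pow_le_pow_iff_left₀ (frobNorm_nonneg _) (frobNorm_nonneg _) two_ne_zero).1 hle

end Proj

/-! ## §2. Locality of the Lie drift -/

section Drift

variable {G : Type*} [Group G] [TopologicalSpace G] (r : LatticeRep G) {d L : ℕ}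

/-- Unfolding the rooted loop `false` (the square `x → x+eᵢ → x+eᵢ+eⱼ → x+eⱼ → x`). [folklore] -/
theorem rootedLoop_false_eq {N : ℕ} (Q : MatrixConfig d L N) (e : Edge d L) (j : Fin d) :
    rootedLoop Q e j false = Q e * Q (e.1.shift e.2, j) * (Q (e.1.shift j, e.2))ᴴ * (Q (e.1, j))ᴴ := rfl

/-- Unfolding the rooted loop `true` (the square `x → x+eᵢ → x+eᵢ-eⱼ → x-eⱼ → x`). [folklore] -/
theorem rootedLoop_true_eq {N : ℕ} (Q : MatrixConfig d L N) (e : Edge d L) (j : Fin d) :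
    rootedLoop Q e j true = Q e * (Q ((e.1 - Pi.single j 1).shift e.2, j))ᴴ * (Q (e.1 - Pi.single j 1, e.2))ᴴ *
      Q (e.1 - Pi.single j 1, j) := rfl

/-- A rooted plaquette loop of a unitary-valued configuration is unitary. [folklore] -/
theorem rootedLoop_mem_unitaryGroup {N : ℕ} (Q : MatrixConfig d L N) (hQ : ∀ f, Q f ∈ Matrix.unitaryGroup (Fin N) ℂ)
    (e : Edge d L) (j : Fin d) (b : Bool) : rootedLoop Q e j b ∈ Matrix.unitaryGroup (Fin N) ℂ := by
  cases b
  · rw [rootedLoop_false_eq]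
    exact mul_four_mem_unitaryGroup (hQ _) (hQ _) (conjTranspose_mem_unitaryGroup (hQ _))
      (conjTranspose_mem_unitaryGroup (hQ _))
  · rw [rootedLoop_true_eq]
    exact mul_four_mem_unitaryGroup (hQ _) (conjTranspose_mem_unitaryGroup (hQ _))
      (conjTranspose_mem_unitaryGroup (hQ _)) (hQ _)

/-- `‖loop‖_F = √N` for a rooted plaquette loop of a unitary-valued configuration. [folklore] -/
theorem frobNorm_rootedLoop {N : ℕ} (Q : MatrixConfig d L N) (hQ : ∀ f, Q f ∈ Matrix.unitaryGroup (Fin N) ℂ)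
    (e : Edge d L) (j : Fin d) (b : Bool) : frobNorm (rootedLoop Q e j b) = Real.sqrt N := by
  rw [frobNorm_of_mem_unitaryGroup (rootedLoop_mem_unitaryGroup Q hQ e j b), Fintype.card_fin]

/-- ★ **The plaquette loop `false` is `1`-Lipschitz in each of its four links** (Frobenius distance, unitary-valued configurations).
[folklore] -/
theorem frobNorm_rootedLoop_false_sub_le {N : ℕ} (Q Q' : MatrixConfig d L N) (hQ : ∀ f, Q f ∈ Matrix.unitaryGroup (Fin N) ℂ)
    (hQ' : ∀ f, Q' f ∈ Matrix.unitaryGroup (Fin N) ℂ) (e : Edge d L) (j : Fin d) :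
    frobNorm (rootedLoop Q e j false - rootedLoop Q' e j false) ≤
      frobNorm (Q e - Q' e) + (frobNorm (Q (e.1.shift e.2, j) - Q' (e.1.shift e.2, j)) +
        frobNorm (Q (e.1.shift j, e.2) - Q' (e.1.shift j, e.2)) + frobNorm (Q (e.1, j) - Q' (e.1, j))) := by
  have hc : ∀ f, frobNorm ((Q f)ᴴ - (Q' f)ᴴ) = frobNorm (Q f - Q' f) := fun f => by
    rw [← Matrix.conjTranspose_sub, frobNorm_conjTranspose]
  rw [rootedLoop_false_eq, rootedLoop_false_eq]
  have h := frobNorm_four_sub_le (Q e) (Q (e.1.shift e.2, j)) ((Q (e.1.shift j, e.2))ᴴ) ((Q (e.1, j))ᴴ)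
    (Q' e) (Q' (e.1.shift e.2, j)) ((Q' (e.1.shift j, e.2))ᴴ) ((Q' (e.1, j))ᴴ)
    (hQ _) (conjTranspose_mem_unitaryGroup (hQ _)) (conjTranspose_mem_unitaryGroup (hQ _))
    (hQ' _) (hQ' _) (conjTranspose_mem_unitaryGroup (hQ' _))
  rw [hc, hc] at h
  linarith

/-- ★ **The plaquette loop `true` is `1`-Lipschitz in each of its four links** (Frobenius distance, unitary-valued configurations).
[folklore] -/
theorem frobNorm_rootedLoop_true_sub_le {N : ℕ} (Q Q' : MatrixConfig d L N) (hQ : ∀ f, Q f ∈ Matrix.unitaryGroup (Fin N) ℂ)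
    (hQ' : ∀ f, Q' f ∈ Matrix.unitaryGroup (Fin N) ℂ) (e : Edge d L) (j : Fin d) :
    frobNorm (rootedLoop Q e j true - rootedLoop Q' e j true) ≤
      frobNorm (Q e - Q' e) + (frobNorm (Q ((e.1 - Pi.single j 1).shift e.2, j) - Q' ((e.1 - Pi.single j 1).shift e.2, j)) +
        frobNorm (Q (e.1 - Pi.single j 1, e.2) - Q' (e.1 - Pi.single j 1, e.2)) +
        frobNorm (Q (e.1 - Pi.single j 1, j) - Q' (e.1 - Pi.single j 1, j))) := by
  have hc : ∀ f, frobNorm ((Q f)ᴴ - (Q' f)ᴴ) = frobNorm (Q f - Q' f) := fun f => by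
    rw [← Matrix.conjTranspose_sub, frobNorm_conjTranspose]
  rw [rootedLoop_true_eq, rootedLoop_true_eq]
  have h := frobNorm_four_sub_le (Q e) ((Q ((e.1 - Pi.single j 1).shift e.2, j))ᴴ) ((Q (e.1 - Pi.single j 1, e.2))ᴴ)
    (Q (e.1 - Pi.single j 1, j)) (Q' e) ((Q' ((e.1 - Pi.single j 1).shift e.2, j))ᴴ) ((Q' (e.1 - Pi.single j 1, e.2))ᴴ)
    (Q' (e.1 - Pi.single j 1, j))
    (conjTranspose_mem_unitaryGroup (hQ _)) (conjTranspose_mem_unitaryGroup (hQ _)) (hQ _)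
    (hQ' _) (conjTranspose_mem_unitaryGroup (hQ' _)) (conjTranspose_mem_unitaryGroup (hQ' _))
  rw [hc, hc] at h
  linarith

/-- `‖D_β(Q)_e‖_F ≤ |β| Σ_{j ≠ e.2} Σ_b ‖loop_{e,j,b}(Q)‖_F` (triangle inequality and `‖𝐩 X‖_F ≤ ‖X‖_F`). [folklore] -/
theorem frobNorm_driftLie_le_sum (β : ℝ) (Q : MatrixConfig d L r.N) (e : Edge d L) :
    frobNorm (r.driftLie β Q e) ≤ |β| * ∑ j ∈ univ.erase e.2, ∑ b : Bool, frobNorm (rootedLoop Q e j b) := by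
  unfold LatticeRep.driftLie
  rw [← Complex.coe_smul, frobNorm_smul, Complex.norm_real, Real.norm_eq_abs]
  refine mul_le_mul_of_nonneg_left ?_ (abs_nonneg _)
  refine (frobNorm_sum_le _ _).trans (Finset.sum_le_sum fun j _ => (frobNorm_sum_le _ _).trans
    (Finset.sum_le_sum fun b _ => ?_))
  exact (frobNorm_lieProj_le r _).trans (le_of_eq (frobNorm_conjTranspose _))

/-- ★ **The Lie drift is bounded on unitary-valued configurations**: `‖D_β(Q)_e‖_F ≤ |β|·#{j ≠ e.2}·2√N` (`2(d−1)` plaquettes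
through a link, each loop unitary). [cite: ShenZhuZhu2022, §3 Lemma 3.1] -/
theorem frobNorm_driftLie_le (β : ℝ) (Q : MatrixConfig d L r.N) (hQ : ∀ f, Q f ∈ Matrix.unitaryGroup (Fin r.N) ℂ)
    (e : Edge d L) :
    frobNorm (r.driftLie β Q e) ≤ |β| * ((univ.erase e.2).card * (2 * Real.sqrt r.N)) := by
  refine (frobNorm_driftLie_le_sum r β Q e).trans (le_of_eq ?_)
  congr 1
  simp only [frobNorm_rootedLoop Q hQ, Finset.sum_const, nsmul_eq_mul, Finset.card_univ, Fintype.card_bool,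
    Nat.cast_ofNat]

/-- ★ **LOCALITY OF THE LIE DRIFT** (explicit, unitary-valued configurations, any `r`, `d`, `L`):
`‖D_β(Q)_e − D_β(Q')_e‖_F ≤ |β| Σ_{j ≠ e.2} [2‖Q_e − Q'_e‖_F + Σ_{f} ‖Q_f − Q'_f‖_F]`, `f` over the six non-root links of the two
plaquettes through `e` in the plane `{e.2, j}` — the drift of a link only feels the links of the plaquettes through it.
[cite: ShenZhuZhu2022, §3 Lemma 3.1] -/
theorem frobNorm_driftLie_sub_le (β : ℝ) (Q Q' : MatrixConfig d L r.N) (hQ : ∀ f, Q f ∈ Matrix.unitaryGroup (Fin r.N) ℂ)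
    (hQ' : ∀ f, Q' f ∈ Matrix.unitaryGroup (Fin r.N) ℂ) (e : Edge d L) :
    frobNorm (r.driftLie β Q e - r.driftLie β Q' e) ≤
      |β| * ∑ j ∈ univ.erase e.2,
        (2 * frobNorm (Q e - Q' e) +
          (frobNorm (Q (e.1.shift e.2, j) - Q' (e.1.shift e.2, j)) + frobNorm (Q (e.1.shift j, e.2) - Q' (e.1.shift j, e.2)) +
            frobNorm (Q (e.1, j) - Q' (e.1, j))) +
          (frobNorm (Q ((e.1 - Pi.single j 1).shift e.2, j) - Q' ((e.1 - Pi.single j 1).shift e.2, j)) +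
            frobNorm (Q (e.1 - Pi.single j 1, e.2) - Q' (e.1 - Pi.single j 1, e.2)) +
            frobNorm (Q (e.1 - Pi.single j 1, j) - Q' (e.1 - Pi.single j 1, j)))) := by
  have hdiff : r.driftLie β Q e - r.driftLie β Q' e =
      β • ∑ j ∈ univ.erase e.2, ∑ b : Bool, r.lieProj (rootedLoop Q e j b - rootedLoop Q' e j b)ᴴ := by
    unfold LatticeRep.driftLie
    rw [← smul_sub, ← Finset.sum_sub_distrib]
    congr 1
    refine Finset.sum_congr rfl fun j _ => ?_
    rw [← Finset.sum_sub_distrib]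
    refine Finset.sum_congr rfl fun b _ => ?_
    rw [Matrix.conjTranspose_sub, map_sub]
  rw [hdiff, ← Complex.coe_smul, frobNorm_smul, Complex.norm_real, Real.norm_eq_abs]
  refine mul_le_mul_of_nonneg_left ?_ (abs_nonneg _)
  refine (frobNorm_sum_le _ _).trans (Finset.sum_le_sum fun j _ => ?_)
  refine (frobNorm_sum_le _ _).trans ?_
  rw [Fintype.sum_bool]
  have hb : ∀ b, frobNorm (r.lieProj (rootedLoop Q e j b - rootedLoop Q' e j b)ᴴ) ≤
      frobNorm (rootedLoop Q e j b - rootedLoop Q' e j b) := fun b =>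
    (frobNorm_lieProj_le r _).trans (le_of_eq (frobNorm_conjTranspose _))
  have ht := (hb true).trans (frobNorm_rootedLoop_true_sub_le Q Q' hQ hQ' e j)
  have hf := (hb false).trans (frobNorm_rootedLoop_false_sub_le Q Q' hQ hQ' e j)
  linarith

end Drift

/-! ## §3. Locality of the Doss–Sussmann field -/

section Field

variable {G : Type*} [Group G] [TopologicalSpace G] (r : LatticeRep G) {d L : ℕ}

/-- ★ **Splitting the Doss–Sussmann field difference.**  For a unitary frame `p` and unitary-valued `M, M'`, with `Q = pM`, `Q' = pM'`
linkwise: `‖F(p,M)_e − F(p,M')_e‖_F ≤ ‖D_β(Q)_e − D_β(Q')_e‖_F + ‖D_β(Q')_e‖_F · ‖M_e − M'_e‖_F`, where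
`F(p,M)_e = p_eᴴ D_β(pM)_e p_e M_e`. [folklore] -/
theorem frobNorm_dossSussmannField_sub_le (β : ℝ) (p M M' : Edge d L → Matrix (Fin r.N) (Fin r.N) ℂ)
    (hp : ∀ f, p f ∈ Matrix.unitaryGroup (Fin r.N) ℂ) (hM : ∀ f, M f ∈ Matrix.unitaryGroup (Fin r.N) ℂ)
    (e : Edge d L) :
    frobNorm ((p e)ᴴ * r.driftLie β (fun f => p f * M f) e * (p e * M e) -
        (p e)ᴴ * r.driftLie β (fun f => p f * M' f) e * (p e * M' e)) ≤
      frobNorm (r.driftLie β (fun f => p f * M f) e - r.driftLie β (fun f => p f * M' f) e) +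
        frobNorm (r.driftLie β (fun f => p f * M' f) e) * frobNorm (M e - M' e) := by
  set D := r.driftLie β (fun f => p f * M f) e with hD
  set D' := r.driftLie β (fun f => p f * M' f) e with hD'
  have hsplit : (p e)ᴴ * D * (p e * M e) - (p e)ᴴ * D' * (p e * M' e) =
      (p e)ᴴ * (D - D') * (p e * M e) + (p e)ᴴ * D' * p e * (M e - M' e) := by
    simp only [Matrix.mul_sub, Matrix.sub_mul, Matrix.mul_assoc]; abel
  rw [hsplit]
  have h1 : frobNorm ((p e)ᴴ * (D - D') * (p e * M e)) = frobNorm (D - D') := by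
    rw [frobNorm_mul_unitary _ (Submonoid.mul_mem _ (hp e) (hM e)), frobNorm_unitary_mul (conjTranspose_mem_unitaryGroup (hp e))]
  -- submultiplicativity of `‖·‖_F` (the Frobenius normed ring structure, used only inside this proof)
  have hmul : ∀ A B : Matrix (Fin r.N) (Fin r.N) ℂ, frobNorm (A * B) ≤ frobNorm A * frobNorm B := by
    intro A B
    letI : NormedRing (Matrix (Fin r.N) (Fin r.N) ℂ) := Matrix.frobeniusNormedRing
    calc frobNorm (A * B) = ‖A * B‖ := frobNorm_eq_norm _
      _ ≤ ‖A‖ * ‖B‖ := norm_mul_le A B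
      _ = frobNorm A * frobNorm B := by congr 1 <;> exact (frobNorm_eq_norm _).symm
  have h2 : frobNorm ((p e)ᴴ * D' * p e * (M e - M' e)) ≤ frobNorm D' * frobNorm (M e - M' e) := by
    refine (hmul _ _).trans (le_of_eq ?_)
    rw [frobNorm_mul_unitary _ (hp e), frobNorm_unitary_mul (conjTranspose_mem_unitaryGroup (hp e))]
  have h3 := frobNorm_add_le ((p e)ᴴ * (D - D') * (p e * M e)) ((p e)ᴴ * D' * p e * (M e - M' e))
  rw [h1] at h3
  linarith

/-- Left multiplication by a unitary frame does not change link distances: `‖p_f M_f − p_f M'_f‖_F = ‖M_f − M'_f‖_F`. [folklore] -/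
theorem frobNorm_frame_mul_sub (p M M' : Edge d L → Matrix (Fin r.N) (Fin r.N) ℂ)
    (hp : ∀ f, p f ∈ Matrix.unitaryGroup (Fin r.N) ℂ) (f : Edge d L) :
    frobNorm (p f * M f - p f * M' f) = frobNorm (M f - M' f) := by
  rw [← Matrix.mul_sub, frobNorm_unitary_mul (hp f)]

/-- ★ **PER-LINK LIPSCHITZ LOCALITY OF THE DOSS–SUSSMANN FIELD, explicit** (any `r`, `d`, `L`; unitary frame and links):
`‖F(p,M)_e − F(p,M')_e‖_F ≤ |β|·(#{j ≠ e.2}·2√N)·‖M_e − M'_e‖_F + |β| Σ_{j ≠ e.2}[2‖M_e − M'_e‖_F + Σ_f ‖M_f − M'_f‖_F]`,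
`f` over the six non-root links of the two plaquettes through `e` in the plane `{e.2, j}`. [folklore] -/
theorem frobNorm_dossSussmannField_sub_le_local (β : ℝ) (p M M' : Edge d L → Matrix (Fin r.N) (Fin r.N) ℂ)
    (hp : ∀ f, p f ∈ Matrix.unitaryGroup (Fin r.N) ℂ) (hM : ∀ f, M f ∈ Matrix.unitaryGroup (Fin r.N) ℂ)
    (hM' : ∀ f, M' f ∈ Matrix.unitaryGroup (Fin r.N) ℂ) (e : Edge d L) :
    frobNorm ((p e)ᴴ * r.driftLie β (fun f => p f * M f) e * (p e * M e) -
        (p e)ᴴ * r.driftLie β (fun f => p f * M' f) e * (p e * M' e)) ≤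
      |β| * ((univ.erase e.2).card * (2 * Real.sqrt r.N)) * frobNorm (M e - M' e) +
      |β| * ∑ j ∈ univ.erase e.2,
        (2 * frobNorm (M e - M' e) +
          (frobNorm (M (e.1.shift e.2, j) - M' (e.1.shift e.2, j)) + frobNorm (M (e.1.shift j, e.2) - M' (e.1.shift j, e.2)) +
            frobNorm (M (e.1, j) - M' (e.1, j))) +
          (frobNorm (M ((e.1 - Pi.single j 1).shift e.2, j) - M' ((e.1 - Pi.single j 1).shift e.2, j)) +
            frobNorm (M (e.1 - Pi.single j 1, e.2) - M' (e.1 - Pi.single j 1, e.2)) +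
            frobNorm (M (e.1 - Pi.single j 1, j) - M' (e.1 - Pi.single j 1, j)))) := by
  have hQ : ∀ f, p f * M f ∈ Matrix.unitaryGroup (Fin r.N) ℂ := fun f => Submonoid.mul_mem _ (hp f) (hM f)
  have hQ' : ∀ f, p f * M' f ∈ Matrix.unitaryGroup (Fin r.N) ℂ := fun f => Submonoid.mul_mem _ (hp f) (hM' f)
  have h0 := frobNorm_dossSussmannField_sub_le r β p M M' hp hM e
  have h1 := frobNorm_driftLie_sub_le r β (fun f => p f * M f) (fun f => p f * M' f) hQ hQ' e
  have h2 := frobNorm_driftLie_le r β (fun f => p f * M' f) hQ' e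
  simp only [frobNorm_frame_mul_sub r p M M' hp] at h1
  have h3 : frobNorm (r.driftLie β (fun f => p f * M' f) e) * frobNorm (M e - M' e) ≤
      |β| * ((univ.erase e.2).card * (2 * Real.sqrt r.N)) * frobNorm (M e - M' e) :=
    mul_le_mul_of_nonneg_right h2 (frobNorm_nonneg _)
  linarith

end Field


end Summit.QuantumFields.YangMills.Theorems.ColdStartUniversality.LiebRobinson
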